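import Literature.AlgebraicGeometry.ComplexMultiplication.CyclotomicFermatCMTypesKoblitzEllipticLevelsSixty
import HarnessLib

/-!
# Koblitz's list of elliptic Fermat levels (Bauer–Coste–Itzykson–Ruelle §3.4 [kob]): BEYOND THE TOP OF THE LIST — no primitive triple with
# `H_{r,s,t}` a group at any level `61 ≤ n ≤ 72`; the kernel census for `3 ≤ n ≤ 72`

Layer `Literature/AlgebraicGeometry/ComplexMultiplication`; sequel of `CyclotomicFermatCMTypesKoblitzEllipticLevelsSixty` (census `3 ≤ n₀ ≤ 60` =
the printed set).  The printed statement is for EVERY `n₀`; its open-ended part «no `n₀ > 60`» is Koblitz's theorem [kob] (N. Koblitz, Duke Math.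
J. 45 (1978) 87–99, NOT held; acq-13294).  THIS FILE pushes the kernel verification twelve levels past the top of the list, `61 ≤ n ≤ 72`
(`72 = 3·24`, the level of `ℚ(ζ₇₂) ⊃ ℚ(ζ₂₄), ℚ(ζ₉)`), with the square pre-test of the prequel (`decide +kernel`, ≈ `6–10 s` per level), and restates
the census for `3 ≤ n ≤ 72`.  THEOREMS ONLY (no definition, no named fact, no `sorry`).  Source and reading as in the prequels
(M. Bauer, A. Coste, C. Itzykson, P. Ruelle, J. Geom. Phys. **22** (1997), §3.4 p. 14, held `paper:arxiv-hep-th_9604104`).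

## What is proved

* §1 `not_exists_primitive_group_triple_sixtyOne … _seventyTwo`: at each level `61, …, 72` NO primitive normalised triple `(r, s, −r−s)` has
  `H_{r,s,t}` closed under multiplication (kernel, exhaustive).
* §2 **`exists_primitive_group_triple_iff_of_le_seventyTwo`** (`3 ≤ n ≤ 72`: such a triple exists iff `n ∈ {3, 4, 6, 7, 8, 12, 15, 16, 18, 20, 21, 22, 24, 30, 39, 40, 48, 60}`),
  **`mem_koblitzList_of_exists_isIsogeny_pow_elliptic_of_le_seventyTwo`** (on abelian varieties).

## Honest column

Numerics, kernel-certified, in support of a theorem whose proof is not held: nothing here replaces [kob] for `n₀ > 72`.  The Hodge conjecture is not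
proved and nothing here bears on it.
-/

noncomputable section

open NumberField

namespace Literature.AlgebraicGeometry.ComplexMultiplication

open CategoryTheory CategoryTheory.Limits
open Literature.AlgebraicGeometry.Motives (CMType AbelianVariety)
open Literature.AlgebraicGeometry.Motives.AbelianVariety
open Literature.NumberTheory.ComplexMultiplication
open Literature.AlgebraicGeometry.HodgeTheory
open Literature.AlgebraicGeometry.Pohlmann1968 Literature.AlgebraicGeometry.Pohlmann1968.Cyclotomic
open CyclotomicCMTypeResidueSets (IsCMResidueSet unitResidues residueSet residueSet_cmTypeOfResidues isCMResidueSet_residueSet)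

namespace CyclotomicFermatCMType

/-! ## §1 The levels `61, …, 72` -/

section Levels

/-- **Level `61`**: NO primitive normalised triple `(r, s, −r−s)` modulo `61` has `H_{r,s,t}` closed under multiplication (kernel, all `(r, s)`;
the square test first). [cite: BauerCosteItzyksonRuelle1997, §3.4] -/
theorem not_exists_primitive_group_triple_sixtyOne :
    ¬∃ r s : ZMod 61, r ≠ 0 ∧ s ≠ 0 ∧ r.val + s.val < 61 ∧ Nat.gcd (Nat.gcd r.val s.val) 61 = 1 ∧
      ∀ a ∈ fermatCMType 61 r s (-(r + s)), ∀ b ∈ fermatCMType 61 r s (-(r + s)), a * b ∈ fermatCMType 61 r s (-(r + s)) :=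
  not_exists_primitive_group_triple_of_sq (by decide +kernel)

/-- **Level `62`**: NO primitive normalised triple `(r, s, −r−s)` modulo `62` has `H_{r,s,t}` closed under multiplication (kernel, all `(r, s)`;
the square test first). [cite: BauerCosteItzyksonRuelle1997, §3.4] -/
theorem not_exists_primitive_group_triple_sixtyTwo :
    ¬∃ r s : ZMod 62, r ≠ 0 ∧ s ≠ 0 ∧ r.val + s.val < 62 ∧ Nat.gcd (Nat.gcd r.val s.val) 62 = 1 ∧
      ∀ a ∈ fermatCMType 62 r s (-(r + s)), ∀ b ∈ fermatCMType 62 r s (-(r + s)), a * b ∈ fermatCMType 62 r s (-(r + s)) :=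
  not_exists_primitive_group_triple_of_sq (by decide +kernel)

/-- **Level `63`**: NO primitive normalised triple `(r, s, −r−s)` modulo `63` has `H_{r,s,t}` closed under multiplication (kernel, all `(r, s)`;
the square test first). [cite: BauerCosteItzyksonRuelle1997, §3.4] -/
theorem not_exists_primitive_group_triple_sixtyThree :
    ¬∃ r s : ZMod 63, r ≠ 0 ∧ s ≠ 0 ∧ r.val + s.val < 63 ∧ Nat.gcd (Nat.gcd r.val s.val) 63 = 1 ∧
      ∀ a ∈ fermatCMType 63 r s (-(r + s)), ∀ b ∈ fermatCMType 63 r s (-(r + s)), a * b ∈ fermatCMType 63 r s (-(r + s)) :=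
  not_exists_primitive_group_triple_of_sq (by decide +kernel)

/-- **Level `64`**: NO primitive normalised triple `(r, s, −r−s)` modulo `64` has `H_{r,s,t}` closed under multiplication (kernel, all `(r, s)`;
the square test first). [cite: BauerCosteItzyksonRuelle1997, §3.4] -/
theorem not_exists_primitive_group_triple_sixtyFour :
    ¬∃ r s : ZMod 64, r ≠ 0 ∧ s ≠ 0 ∧ r.val + s.val < 64 ∧ Nat.gcd (Nat.gcd r.val s.val) 64 = 1 ∧
      ∀ a ∈ fermatCMType 64 r s (-(r + s)), ∀ b ∈ fermatCMType 64 r s (-(r + s)), a * b ∈ fermatCMType 64 r s (-(r + s)) :=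
  not_exists_primitive_group_triple_of_sq (by decide +kernel)

/-- **Level `65`**: NO primitive normalised triple `(r, s, −r−s)` modulo `65` has `H_{r,s,t}` closed under multiplication (kernel, all `(r, s)`;
the square test first). [cite: BauerCosteItzyksonRuelle1997, §3.4] -/
theorem not_exists_primitive_group_triple_sixtyFive :
    ¬∃ r s : ZMod 65, r ≠ 0 ∧ s ≠ 0 ∧ r.val + s.val < 65 ∧ Nat.gcd (Nat.gcd r.val s.val) 65 = 1 ∧
      ∀ a ∈ fermatCMType 65 r s (-(r + s)), ∀ b ∈ fermatCMType 65 r s (-(r + s)), a * b ∈ fermatCMType 65 r s (-(r + s)) :=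
  not_exists_primitive_group_triple_of_sq (by decide +kernel)

/-- **Level `66`**: NO primitive normalised triple `(r, s, −r−s)` modulo `66` has `H_{r,s,t}` closed under multiplication (kernel, all `(r, s)`;
the square test first). [cite: BauerCosteItzyksonRuelle1997, §3.4] -/
theorem not_exists_primitive_group_triple_sixtySix :
    ¬∃ r s : ZMod 66, r ≠ 0 ∧ s ≠ 0 ∧ r.val + s.val < 66 ∧ Nat.gcd (Nat.gcd r.val s.val) 66 = 1 ∧
      ∀ a ∈ fermatCMType 66 r s (-(r + s)), ∀ b ∈ fermatCMType 66 r s (-(r + s)), a * b ∈ fermatCMType 66 r s (-(r + s)) :=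
  not_exists_primitive_group_triple_of_sq (by decide +kernel)

/-- **Level `67`**: NO primitive normalised triple `(r, s, −r−s)` modulo `67` has `H_{r,s,t}` closed under multiplication (kernel, all `(r, s)`;
the square test first). [cite: BauerCosteItzyksonRuelle1997, §3.4] -/
theorem not_exists_primitive_group_triple_sixtySeven :
    ¬∃ r s : ZMod 67, r ≠ 0 ∧ s ≠ 0 ∧ r.val + s.val < 67 ∧ Nat.gcd (Nat.gcd r.val s.val) 67 = 1 ∧
      ∀ a ∈ fermatCMType 67 r s (-(r + s)), ∀ b ∈ fermatCMType 67 r s (-(r + s)), a * b ∈ fermatCMType 67 r s (-(r + s)) :=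
  not_exists_primitive_group_triple_of_sq (by decide +kernel)

/-- **Level `68`**: NO primitive normalised triple `(r, s, −r−s)` modulo `68` has `H_{r,s,t}` closed under multiplication (kernel, all `(r, s)`;
the square test first). [cite: BauerCosteItzyksonRuelle1997, §3.4] -/
theorem not_exists_primitive_group_triple_sixtyEight :
    ¬∃ r s : ZMod 68, r ≠ 0 ∧ s ≠ 0 ∧ r.val + s.val < 68 ∧ Nat.gcd (Nat.gcd r.val s.val) 68 = 1 ∧
      ∀ a ∈ fermatCMType 68 r s (-(r + s)), ∀ b ∈ fermatCMType 68 r s (-(r + s)), a * b ∈ fermatCMType 68 r s (-(r + s)) :=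
  not_exists_primitive_group_triple_of_sq (by decide +kernel)

/-- **Level `69`**: NO primitive normalised triple `(r, s, −r−s)` modulo `69` has `H_{r,s,t}` closed under multiplication (kernel, all `(r, s)`;
the square test first). [cite: BauerCosteItzyksonRuelle1997, §3.4] -/
theorem not_exists_primitive_group_triple_sixtyNine :
    ¬∃ r s : ZMod 69, r ≠ 0 ∧ s ≠ 0 ∧ r.val + s.val < 69 ∧ Nat.gcd (Nat.gcd r.val s.val) 69 = 1 ∧
      ∀ a ∈ fermatCMType 69 r s (-(r + s)), ∀ b ∈ fermatCMType 69 r s (-(r + s)), a * b ∈ fermatCMType 69 r s (-(r + s)) :=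
  not_exists_primitive_group_triple_of_sq (by decide +kernel)

/-- **Level `70`**: NO primitive normalised triple `(r, s, −r−s)` modulo `70` has `H_{r,s,t}` closed under multiplication (kernel, all `(r, s)`;
the square test first). [cite: BauerCosteItzyksonRuelle1997, §3.4] -/
theorem not_exists_primitive_group_triple_seventy :
    ¬∃ r s : ZMod 70, r ≠ 0 ∧ s ≠ 0 ∧ r.val + s.val < 70 ∧ Nat.gcd (Nat.gcd r.val s.val) 70 = 1 ∧
      ∀ a ∈ fermatCMType 70 r s (-(r + s)), ∀ b ∈ fermatCMType 70 r s (-(r + s)), a * b ∈ fermatCMType 70 r s (-(r + s)) :=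
  not_exists_primitive_group_triple_of_sq (by decide +kernel)

/-- **Level `71`**: NO primitive normalised triple `(r, s, −r−s)` modulo `71` has `H_{r,s,t}` closed under multiplication (kernel, all `(r, s)`;
the square test first). [cite: BauerCosteItzyksonRuelle1997, §3.4] -/
theorem not_exists_primitive_group_triple_seventyOne :
    ¬∃ r s : ZMod 71, r ≠ 0 ∧ s ≠ 0 ∧ r.val + s.val < 71 ∧ Nat.gcd (Nat.gcd r.val s.val) 71 = 1 ∧
      ∀ a ∈ fermatCMType 71 r s (-(r + s)), ∀ b ∈ fermatCMType 71 r s (-(r + s)), a * b ∈ fermatCMType 71 r s (-(r + s)) :=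
  not_exists_primitive_group_triple_of_sq (by decide +kernel)

/-- **Level `72`**: NO primitive normalised triple `(r, s, −r−s)` modulo `72` has `H_{r,s,t}` closed under multiplication (kernel, all `(r, s)`;
the square test first). [cite: BauerCosteItzyksonRuelle1997, §3.4] -/
theorem not_exists_primitive_group_triple_seventyTwo :
    ¬∃ r s : ZMod 72, r ≠ 0 ∧ s ≠ 0 ∧ r.val + s.val < 72 ∧ Nat.gcd (Nat.gcd r.val s.val) 72 = 1 ∧
      ∀ a ∈ fermatCMType 72 r s (-(r + s)), ∀ b ∈ fermatCMType 72 r s (-(r + s)), a * b ∈ fermatCMType 72 r s (-(r + s)) :=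
  not_exists_primitive_group_triple_of_sq (by decide +kernel)

end Levels

/-! ## §2 The census `3 ≤ n ≤ 72` -/

section Census

/-- **THE KERNEL CENSUS FOR `3 ≤ n ≤ 72`.**  A primitive normalised triple `(r, s, −r−s)` modulo `n` with `H_{r,s,t}` closed under multiplication
exists iff `n ∈ {3, 4, 6, 7, 8, 12, 15, 16, 18, 20, 21, 22, 24, 30, 39, 40, 48, 60}` — the printed set, and nothing in `61 ≤ n ≤ 72`.
[cite: BauerCosteItzyksonRuelle1997, §3.4] -/
theorem exists_primitive_group_triple_iff_of_le_seventyTwo (n : ℕ) [hnz : NeZero n] (h3 : 3 ≤ n) (h72 : n ≤ 72) :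
    (∃ r s : ZMod n, r ≠ 0 ∧ s ≠ 0 ∧ r.val + s.val < n ∧ Nat.gcd (Nat.gcd r.val s.val) n = 1 ∧
      ∀ a ∈ fermatCMType n r s (-(r + s)), ∀ b ∈ fermatCMType n r s (-(r + s)), a * b ∈ fermatCMType n r s (-(r + s))) ↔
    n ∈ ({3, 4, 6, 7, 8, 12, 15, 16, 18, 20, 21, 22, 24, 30, 39, 40, 48, 60} : Finset ℕ) := by
  by_cases h60 : n ≤ 60
  · exact exists_primitive_group_triple_iff_of_le_sixty n h3 h60
  · have h61 : 61 ≤ n := by omega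
    interval_cases n <;> (obtain rfl : hnz = ⟨by decide⟩ := Subsingleton.elim _ _)
    · exact iff_of_false not_exists_primitive_group_triple_sixtyOne (by decide)
    · exact iff_of_false not_exists_primitive_group_triple_sixtyTwo (by decide)
    · exact iff_of_false not_exists_primitive_group_triple_sixtyThree (by decide)
    · exact iff_of_false not_exists_primitive_group_triple_sixtyFour (by decide)
    · exact iff_of_false not_exists_primitive_group_triple_sixtyFive (by decide)
    · exact iff_of_false not_exists_primitive_group_triple_sixtySix (by decide)
    · exact iff_of_false not_exists_primitive_group_triple_sixtySeven (by decide)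
    · exact iff_of_false not_exists_primitive_group_triple_sixtyEight (by decide)
    · exact iff_of_false not_exists_primitive_group_triple_sixtyNine (by decide)
    · exact iff_of_false not_exists_primitive_group_triple_seventy (by decide)
    · exact iff_of_false not_exists_primitive_group_triple_seventyOne (by decide)
    · exact iff_of_false not_exists_primitive_group_triple_seventyTwo (by decide)

variable {n : ℕ} [NeZero n] {L : Type} [Field L] [NumberField L] [IsCyclotomicExtension {n} ℚ L]

/-- **On abelian varieties, up to `72`**: if some realisation of some primitive normalised K–R type at a level `3 ≤ n ≤ 72` is isogenous to a
power of an elliptic curve, then `n` is in the printed set. [cite: BauerCosteItzyksonRuelle1997, §3.4] [cite: KoblitzRohrlich1978, §1 p. 1184] -/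
theorem mem_koblitzList_of_exists_isIsogeny_pow_elliptic_of_le_seventyTwo (h3 : 3 ≤ n) (h72 : n ≤ 72) {r s : ZMod n} (hr : r ≠ 0) (hs : s ≠ 0)
    (hrs : r.val + s.val < n) (hprim : Nat.gcd (Nat.gcd r.val s.val) n = 1)
    {hS : ∀ c : ZMod n, c.val.Coprime n → (c ∈ fermatCMType n r s (-(r + s)) ↔ -c ∉ fermatCMType n r s (-(r + s)))}
    {A : AbelianVariety ℂ} {ι : 𝓞 L →+* End A} {θ : L →+* Module.End ℂ (complexBetti A.X 1)}
    (hA : IsCMTypeRealisation (cmTypeOfResidues (L := L) (fermatCMType n r s (-(r + s))) hS) A ι θ)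
    (hE : ∃ (E P : AbelianVariety ℂ) (h : ℕ) (π : Fin h → (P ⟶ E)) (g : A ⟶ P),
      E.dim = 1 ∧ Nonempty (IsLimit (Fan.mk P π)) ∧ IsIsogeny g) :
    n ∈ ({3, 4, 6, 7, 8, 12, 15, 16, 18, 20, 21, 22, 24, 30, 39, 40, 48, 60} : Finset ℕ) := by
  have hn2 : 2 < n := by omega
  haveI : IsCMField L := IsCyclotomicExtension.Rat.isCMField L (S := {n}) ⟨n, rfl, hn2⟩
  have hcl := (exists_isIsogeny_pow_elliptic_fermat_iff_forall_mul_mem hn2 (one_mem_fermatCMType_of_val_add_lt hr hrs) hA).1 hE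
  exact (exists_primitive_group_triple_iff_of_le_seventyTwo n h3 h72).1 ⟨r, s, hr, hs, hrs, hprim, hcl⟩

end Census

end CyclotomicFermatCMType

end Literature.AlgebraicGeometry.ComplexMultiplication
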